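import Literature.NumberTheory.Transcendental.AssociatorsRegularisation
import Literature.NumberTheory.Transcendental.MultipleZetaStar

/-!
# `DoubleShuffleInKZ` (stmt-KontsevichZagierPeriods-14665, route `FurushoPentagon`): the harmonic algebra
# behind the reduction to the Kaneko–Yamamoto integral–series family

Helper file (`--supports stmt-KontsevichZagierPeriods-14665`), first of two.  The support item
`DoubleShuffleInKZ` is, by `FurushoPentagonDoubleShuffleInKZReduction.lean`, equivalent to IKZ's
regularised family (v): `Σ_{u ∈ s ∗ 1ˡ} ⟨ψ, reg_ш u⟩ = 0` (`s ≠ ∅` admissible, `l ≥ 1`).  The companion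
file `FurushoPentagonDoubleShuffleInKZIntegralSeries.lean` derives that family from the "integral = series"
identities of M. Kaneko and S. Yamamoto [KanekoYamamoto2018, Thm 4.1] with `l = (1, …, 1)`, i.e. — in the
tree's conventions, for an admissible index `u = (b+1) t` and `j ≥ 1` —

  `Σ_{w ∈ yʲ ш v} Z(x w) = Σ_{c ∈ (1^{j+1})⋆} Σ_{w ∈ t ∗ c.tail} Z((b + c₁) w)`   (`x v = binaryWord u`),

a LINEAR family of identities among CONVERGENT multiple zeta integrals (no regularisation), whose left
side is one `V`-shaped 2-poset integral dissected into its linear extensions (Yamamoto) and whose right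
side is its series evaluation (`(1ⁿ)⋆` = `MZV.starIndices (1ⁿ)` = the compositions of `n`).

PURE ALGEBRA proved here (no MZVs, no realisations; an arbitrary test function `g` / `Θ` on indices with
values in a commutative ring):
* `eh_cancellation` — the identity `Σ_{i=0}^{l} (-1)^i h_i e_{l-i} = 0` (`l ≥ 1`) of the harmonic
  (quasi-shuffle) algebra in the form `Σ_i (-1)^i Σ_{c ∈ (1ⁱ)⋆} Σ_{v ∈ 1^{l-i} ∗ c} Θ v = 0`
  [Hoffman1997, §2]: after ONE step of Hoffman's recursion (A3) in the first letter every term occurs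
  twice with opposite signs (`formal_cancellation`, a sign identity valid for any family);
* `delta_identity` — the compatibility identity (δ): substituting the Kaneko–Yamamoto right-hand sides
  for `(-1)^i ⟨ψ, reg_ш(yⁱ x v)⟩` in the leading-ones decomposition of `Σ_{u ∈ s ∗ 1ˡ} ⟨ψ, reg_ш u⟩`
  gives identically `0` (associativity of `∗` [Hoffman1997, Thm 2.1] = `MZV.sumStuffle_assoc`, a
  telescoping of the parts `e ≥ 1`, and `eh_cancellation` for the part `e = 0`);
* `sumStuffle_cons_replicate_one_eq` — the leading-ones decomposition of `(a t) ∗ 1ˡ` itself.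
This is a `T = 0` sharpening of [KanekoYamamoto2018, Thm 4.6 / Prop. 5.4] ("integral–series identity
⟺ regularisation theorem"): neither the finite double shuffle nor the map `ρ` nor Hoffman's structure
theorem `𝔥¹ = 𝔥⁰[y]` is needed to reach IKZ's family (v) from the integral–series identities.

References: M. Kaneko, S. Yamamoto, Selecta Math. 24 (2018) 2499–2521, §2, Thm 4.1, Thm 4.6, Lemma 5.2,
Prop. 5.4 (arXiv:1605.03117); M. E. Hoffman, J. Algebra 194 (1997), §2 (A1)–(A3), Thm 2.1, Thm 3.1;
K. Ihara, M. Kaneko, D. Zagier, Compos. Math. 142 (2006), Thm 2 (v).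
-/

noncomputable section

open scoped BigOperators

namespace Summit.KontsevichZagierPeriods.FurushoPentagon.DoubleShuffleInKZ.IntegralSeries

open Literature.NumberTheory.Transcendental
open Literature.NumberTheory.Transcendental.MZV (starIndices sumStuffle)

variable {K : Type*} [CommRing K]

/-! ### The compositions sum `𝒮ₙ(Φ) = Σ_{c ∈ (1ⁿ)⋆} Φ(c)` and the mixed sums `T(Θ, m, i)` -/

/-- `Σ` over the star of `1^{k+1}` by the first part `1 + j`:
`Σ_{c ∈ (1^{k+1})⋆} Φ c = Σ_{j ≤ k} Σ_{d ∈ (1^{k-j})⋆} Φ ((1+j) d)`. [cite: KanekoYamamoto2018, §2 (k⋆)] -/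
theorem sum_star_succ {M : Type*} [AddCommMonoid M] (Φ : List ℕ → M) (k : ℕ) :
    ((starIndices (List.replicate (k + 1) 1)).map Φ).sum =
      ∑ j ∈ Finset.range (k + 1),
        ((starIndices (List.replicate (k - j) 1)).map (Φ ∘ List.cons (1 + j))).sum := by
  rw [List.replicate_succ]
  exact MZV.sum_map_starIndices_cons_replicate_one Φ 1 k

/-- **One step of the (A3)-recursion on the mixed sums**
`T(Θ, m, i) = Σ_{c ∈ (1ⁱ)⋆} Σ_{v ∈ 1ᵐ ∗ c} Θ v`: for `m + 1` ones and `k + 1` parts,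
`T(Θ, m+1, k+1) = T(Θ(1·), m, k+1) + Σ_{j ≤ k} [T(Θ((1+j)·), m+1, k-j) + T(Θ((2+j)·), m, k-j)]`
(first letter `1` from the ones, or the first part `1+j`, or their contraction `2+j`).
[cite: Hoffman1997, §2 (A3)] -/
theorem T_succ_succ (Θ : List ℕ → K) (m k : ℕ) :
    ((starIndices (List.replicate (k + 1) 1)).map fun c =>
        sumStuffle Θ (List.replicate (m + 1) 1) c).sum =
      ((starIndices (List.replicate (k + 1) 1)).map fun c =>
          sumStuffle (Θ ∘ List.cons 1) (List.replicate m 1) c).sum +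
        ∑ j ∈ Finset.range (k + 1),
          (((starIndices (List.replicate (k - j) 1)).map fun d =>
              sumStuffle (Θ ∘ List.cons (1 + j)) (List.replicate (m + 1) 1) d).sum +
            ((starIndices (List.replicate (k - j) 1)).map fun d =>
              sumStuffle (Θ ∘ List.cons (2 + j)) (List.replicate m 1) d).sum) := by
  rw [sum_star_succ, sum_star_succ, ← Finset.sum_add_distrib]
  refine Finset.sum_congr rfl fun j _ => ?_
  rw [← List.sum_map_add, ← List.sum_map_add]
  refine congrArg List.sum (List.map_congr_left fun d _ => ?_)
  simp only [Function.comp_apply]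
  rw [List.replicate_succ, MZV.sumStuffle_cons_cons, ← List.replicate_succ,
    show 1 + (1 + j) = 2 + j by ring, add_assoc]

/-- The case without ones: `T(Θ, 0, k+1) = Σ_{j ≤ k} T(Θ((1+j)·), 0, k-j)`. [cite: Hoffman1997, §2 (A1)] -/
theorem T_zero_succ (Θ : List ℕ → K) (k : ℕ) :
    ((starIndices (List.replicate (k + 1) 1)).map fun c => sumStuffle Θ (List.replicate 0 1) c).sum =
      ∑ j ∈ Finset.range (k + 1),
        ((starIndices (List.replicate (k - j) 1)).map fun d =>
          sumStuffle (Θ ∘ List.cons (1 + j)) (List.replicate 0 1) d).sum := by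
  rw [sum_star_succ]
  simp only [List.replicate_zero, Function.comp_def, MZV.sumStuffle_nil_left]

/-- The case without parts: `T(Θ, m, 0) = Θ(1ᵐ)`. [cite: Hoffman1997, §2 (A1)] -/
theorem T_zero_right (Θ : List ℕ → K) (m : ℕ) :
    ((starIndices (List.replicate 0 1)).map fun c => sumStuffle Θ (List.replicate m 1) c).sum =
      Θ (List.replicate m 1) := by
  simp

/-- **The formal cancellation behind the `e`–`h` identity**: for ANY family `Y c m i`
(read: `T(Θ(c·), m, i)`), the signed sum of the one-step expansions vanishes identically —
type-1 terms against the `j = 0` type-2 terms, the `j ≥ 1` type-2 terms against the type-3 terms.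
[folklore] -/
theorem formal_cancellation (Y : ℕ → ℕ → ℕ → K) (L : ℕ) :
    ∑ k ∈ Finset.range L, (-1 : K) ^ (k + 1) *
        (Y 1 (L - 1 - k) (k + 1) +
          ∑ j ∈ Finset.range (k + 1), (Y (1 + j) (L - k) (k - j) + Y (2 + j) (L - 1 - k) (k - j))) +
      (-1 : K) ^ (L + 1) * ∑ j ∈ Finset.range (L + 1), Y (1 + j) (L - L) (L - j) +
      Y 1 L 0 = 0 := by
  -- F(k,j) = Y(1+j)(L-k)(k-j); G(k,j) = Y(2+j)(L-1-k)(k-j); A(k) = Y 1 (L-1-k) (k+1)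
  have step1 : ∑ k ∈ Finset.range L, (-1 : K) ^ (k + 1) *
        (Y 1 (L - 1 - k) (k + 1) +
          ∑ j ∈ Finset.range (k + 1), (Y (1 + j) (L - k) (k - j) + Y (2 + j) (L - 1 - k) (k - j))) +
      (-1 : K) ^ (L + 1) * ∑ j ∈ Finset.range (L + 1), Y (1 + j) (L - L) (L - j) =
      ∑ k ∈ Finset.range L, (-1 : K) ^ (k + 1) * Y 1 (L - 1 - k) (k + 1) +
      ∑ k ∈ Finset.range L, (-1 : K) ^ (k + 1) *
          ∑ j ∈ Finset.range (k + 1), Y (2 + j) (L - 1 - k) (k - j) +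
      ∑ k ∈ Finset.range (L + 1), (-1 : K) ^ (k + 1) *
          ∑ j ∈ Finset.range (k + 1), Y (1 + j) (L - k) (k - j) := by
    rw [Finset.sum_range_succ (fun k => (-1 : K) ^ (k + 1) *
      ∑ j ∈ Finset.range (k + 1), Y (1 + j) (L - k) (k - j))]
    simp only [mul_add, Finset.sum_add_distrib]
    abel
  rw [step1]
  -- split j = 0 / j = j'+1 in the F-sums
  have step2 : ∀ k : ℕ, ∑ j ∈ Finset.range (k + 1), Y (1 + j) (L - k) (k - j) =
      Y 1 (L - k) k + ∑ j ∈ Finset.range k, Y (2 + j) (L - k) (k - 1 - j) := by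
    intro k
    rw [Finset.sum_range_succ', add_comm]
    congr 1
    refine Finset.sum_congr rfl fun j _ => ?_
    rw [show 1 + (j + 1) = 2 + j by ring, show k - (j + 1) = k - 1 - j by omega]
  simp only [step2, mul_add, Finset.sum_add_distrib]
  -- the `Y 1`-terms: A-terms + d-term against the j=0 F-terms
  have step3 : ∑ k ∈ Finset.range L, (-1 : K) ^ (k + 1) * Y 1 (L - 1 - k) (k + 1) + Y 1 L 0 =
      ∑ k ∈ Finset.range (L + 1), (-1 : K) ^ k * Y 1 (L - k) k := by
    rw [Finset.sum_range_succ' (fun k => (-1 : K) ^ k * Y 1 (L - k) k)]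
    simp only [pow_zero, one_mul, Nat.sub_zero]
    congr 1
    refine Finset.sum_congr rfl fun k _ => ?_
    rw [show L - (k + 1) = L - 1 - k by omega]
  have step3' : ∑ k ∈ Finset.range (L + 1), (-1 : K) ^ (k + 1) * Y 1 (L - k) k =
      -∑ k ∈ Finset.range (L + 1), (-1 : K) ^ k * Y 1 (L - k) k := by
    rw [← Finset.sum_neg_distrib]
    refine Finset.sum_congr rfl fun k _ => ?_
    rw [pow_succ]; ring
  -- the `Y (2+j)`-terms: shift k = k'+1 in the F-part
  have step4 : ∑ k ∈ Finset.range (L + 1), (-1 : K) ^ (k + 1) *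
        ∑ j ∈ Finset.range k, Y (2 + j) (L - k) (k - 1 - j) =
      -∑ k ∈ Finset.range L, (-1 : K) ^ (k + 1) *
          ∑ j ∈ Finset.range (k + 1), Y (2 + j) (L - 1 - k) (k - j) := by
    rw [Finset.sum_range_succ' (fun k => (-1 : K) ^ (k + 1) *
        ∑ j ∈ Finset.range k, Y (2 + j) (L - k) (k - 1 - j))]
    simp only [Finset.range_zero, Finset.sum_empty, mul_zero, add_zero, ← Finset.sum_neg_distrib]
    refine Finset.sum_congr rfl fun k _ => ?_
    rw [show L - (k + 1) = L - 1 - k by omega, Nat.add_sub_cancel, pow_succ]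
    ring
  rw [step4]
  have := step3
  have := step3'
  linear_combination step3 + step3'

/-- **The `e`–`h` cancellation in the harmonic algebra** (`Σ_{i=0}^{l} (-1)^i h_i e_{l-i} = 0` for
`l ≥ 1`, with `e_m = 1ᵐ` and `h_i = (1ⁱ)⋆`, tested against an arbitrary function):
`Σ_{i=0}^{L+1} (-1)^i Σ_{c ∈ (1ⁱ)⋆} Σ_{v ∈ 1^{L+1-i} ∗ c} Θ v = 0`.  After one step of the (A3)
recursion in the first letter every term occurs twice with opposite signs
(`formal_cancellation`). [cite: Hoffman1997, §2] -/
theorem eh_cancellation (L : ℕ) (Θ : List ℕ → K) :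
    ∑ i ∈ Finset.range (L + 2), (-1 : K) ^ i *
      ((starIndices (List.replicate i 1)).map fun c =>
        sumStuffle Θ (List.replicate (L + 1 - i) 1) c).sum = 0 := by
  -- name the mixed sums
  set T : (List ℕ → K) → ℕ → ℕ → K := fun Θ m i =>
    ((starIndices (List.replicate i 1)).map fun c => sumStuffle Θ (List.replicate m 1) c).sum with hT
  have hT' : ∀ Θ' m i, ((starIndices (List.replicate i 1)).map fun c =>
      sumStuffle Θ' (List.replicate m 1) c).sum = T Θ' m i := fun _ _ _ => rfl
  -- the three recursions
  have R : ∀ Θ' m k, T Θ' (m + 1) (k + 1) = T (Θ' ∘ List.cons 1) m (k + 1) +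
      ∑ j ∈ Finset.range (k + 1), (T (Θ' ∘ List.cons (1 + j)) (m + 1) (k - j) +
        T (Θ' ∘ List.cons (2 + j)) m (k - j)) := fun Θ' m k => by
    simp only [hT]; exact T_succ_succ Θ' m k
  have R0 : ∀ Θ' k, T Θ' 0 (k + 1) =
      ∑ j ∈ Finset.range (k + 1), T (Θ' ∘ List.cons (1 + j)) 0 (k - j) := fun Θ' k => by
    simp only [hT]; exact T_zero_succ Θ' k
  have Rz : ∀ Θ' m, T Θ' m 0 = Θ' (List.replicate m 1) := fun Θ' m => by
    simp only [hT]; exact T_zero_right Θ' m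
  simp only [hT']
  -- peel `i = 0` and split `k < L` / `k = L`
  rw [Finset.sum_range_succ', Finset.sum_range_succ]
  simp only [pow_zero, one_mul, Nat.sub_zero, Nat.add_sub_add_right]
  have hk : ∀ k ∈ Finset.range L, (-1 : K) ^ (k + 1) * T Θ (L - k) (k + 1) =
      (-1 : K) ^ (k + 1) * (T (Θ ∘ List.cons 1) (L - 1 - k) (k + 1) +
        ∑ j ∈ Finset.range (k + 1), (T (Θ ∘ List.cons (1 + j)) (L - k) (k - j) +
          T (Θ ∘ List.cons (2 + j)) (L - 1 - k) (k - j))) := by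
    intro k hk
    rw [Finset.mem_range] at hk
    obtain ⟨m, hm⟩ : ∃ m, L - k = m + 1 := ⟨L - k - 1, by omega⟩
    rw [hm, R, show L - 1 - k = m by omega]
  rw [Finset.sum_congr rfl hk, Nat.sub_self, R0]
  have e0 : T Θ (L + 1) 0 = T (Θ ∘ List.cons 1) L 0 := by
    rw [Rz, Rz]; rfl
  rw [e0]
  have key := formal_cancellation (fun c m i => T (Θ ∘ List.cons c) m i) L
  simp only [Nat.sub_self] at key
  exact key

/-! ### The compatibility identity (δ): IKZ's family (v) against the integral–series family -/

/-- Interchanging a list sum with a finite sum. [folklore] -/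
theorem list_sum_map_finset_sum {M : Type*} [AddCommMonoid M] {ι β : Type*} (S : Finset ι)
    (Φ : ι → β → M) (L : List β) :
    (L.map fun c => ∑ x ∈ S, Φ x c).sum = ∑ x ∈ S, (L.map (Φ x)).sum := by
  induction L with
  | nil => simp
  | cons c L ih => simp [Finset.sum_add_distrib, ih]

/-- Interchanging two list sums. [folklore] -/
theorem list_sum_map_comm {M : Type*} [AddCommMonoid M] {β γ : Type*} (H : β → γ → M)
    (L : List β) (N : List γ) :
    (L.map fun x => (N.map (H x)).sum).sum = (N.map fun y => (L.map fun x => H x y).sum).sum := by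
  induction L with
  | nil => simp
  | cons x L ih =>
    rw [List.map_cons, List.sum_cons, ih]
    simp only [List.map_cons, List.sum_cons]
    exact List.sum_map_add.symm

/-- `Σ_{u ∈ s ∗ t}` only sees the values on `s ∗ t`. [folklore] -/
theorem sumStuffle_congr {M : Type*} [AddCommMonoid M] {f f' : List ℕ → M} {s t : List ℕ}
    (h : ∀ u ∈ MZV.stuffle s t, f u = f' u) : sumStuffle f s t = sumStuffle f' s t :=
  congrArg List.sum (List.map_congr_left h)

/-- Constants come out of `Σ_{u ∈ s ∗ t}`. [folklore] -/
theorem sumStuffle_mul_left (c : K) (f : List ℕ → K) (s t : List ℕ) :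
    sumStuffle (fun u => c * f u) s t = c * sumStuffle f s t := by
  simp [MZV.sumStuffle, List.sum_map_mul_left]

/-- `Σ_{u ∈ s ∗ t}` of a finite sum of functions. [folklore] -/
theorem sumStuffle_finset_sum {M : Type*} [AddCommMonoid M] {ι : Type*} (S : Finset ι)
    (Φ : ι → List ℕ → M) (s t : List ℕ) :
    sumStuffle (fun u => ∑ x ∈ S, Φ x u) s t = ∑ x ∈ S, sumStuffle (Φ x) s t :=
  list_sum_map_finset_sum S Φ _

/-- `Σ_{u ∈ s ∗ t}` of a list sum of functions. [folklore] -/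
theorem sumStuffle_list_sum {M : Type*} [AddCommMonoid M] {γ : Type*} (N : List γ)
    (H : List ℕ → γ → M) (s t : List ℕ) :
    sumStuffle (fun u => (N.map (H u)).sum) s t = (N.map fun y => sumStuffle (fun u => H u y) s t).sum :=
  list_sum_map_comm H _ N

/-- **The integral–series value summed over a harmonic product with ones**: with
`F(i, b, t') = Σ_{c ∈ (1^{i+1})⋆} Σ_{w ∈ t' ∗ c.tail} g((b + c₁) w)` (the right-hand side of the
Kaneko–Yamamoto identity for the index `(b+1) t'` and `i` letters `y`),
`Σ_{t' ∈ t ∗ 1ᵐ} F(i, b, t') = Σ_{e ≤ i} T(Θ_{b+1+e}, m, i - e)` where `Θ_c(v) = Σ_{w ∈ t ∗ v} g(c w)`: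
expand the star by its first part (`sum_star_succ`) and re-associate `(t ∗ 1ᵐ) ∗ d = t ∗ (1ᵐ ∗ d)`
(`MZV.sumStuffle_assoc`). [cite: KanekoYamamoto2018, Thm 4.1; Hoffman1997, Thm 2.1] -/
theorem sumStuffle_F_eq (g : List ℕ → K) (t : List ℕ) (i b m : ℕ) :
    sumStuffle (fun t' => ((starIndices (List.replicate (i + 1) 1)).map fun c =>
        sumStuffle (g ∘ List.cons (b + c.headD 0)) t' c.tail).sum) t (List.replicate m 1) =
      ∑ e ∈ Finset.range (i + 1), ((starIndices (List.replicate (i - e) 1)).map fun d =>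
        sumStuffle (fun v => sumStuffle (g ∘ List.cons (b + 1 + e)) t v) (List.replicate m 1) d).sum := by
  have h1 : ∀ t' : List ℕ, ((starIndices (List.replicate (i + 1) 1)).map fun c =>
      sumStuffle (g ∘ List.cons (b + c.headD 0)) t' c.tail).sum =
      ∑ e ∈ Finset.range (i + 1), ((starIndices (List.replicate (i - e) 1)).map fun d =>
        sumStuffle (g ∘ List.cons (b + 1 + e)) t' d).sum := by
    intro t'
    rw [sum_star_succ]
    refine Finset.sum_congr rfl fun e _ => congrArg List.sum (List.map_congr_left fun d _ => ?_)
    simp [Nat.add_assoc]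
  simp_rw [h1]
  rw [sumStuffle_finset_sum]
  refine Finset.sum_congr rfl fun e _ => ?_
  rw [sumStuffle_list_sum]
  refine congrArg List.sum (List.map_congr_left fun d _ => ?_)
  exact MZV.sumStuffle_assoc (g ∘ List.cons (b + 1 + e)) t (List.replicate m 1) d

/-- Formal telescoping of the `e ≥ 1` parts: for any double family `X i e`,
`Σ_{i ≤ L+1} (-1)^i Σ_{e ≤ i} X i e + Σ_{i ≤ L} (-1)^i Σ_{e ≤ i} X (i+1) (e+1) = Σ_{i ≤ L+1} (-1)^i X i 0`.
[folklore] -/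
theorem formal_telescope (X : ℕ → ℕ → K) (L : ℕ) :
    ∑ i ∈ Finset.range (L + 2), (-1 : K) ^ i * ∑ e ∈ Finset.range (i + 1), X i e +
      ∑ i ∈ Finset.range (L + 1), (-1 : K) ^ i * ∑ e ∈ Finset.range (i + 1), X (i + 1) (e + 1) =
      ∑ i ∈ Finset.range (L + 2), (-1 : K) ^ i * X i 0 := by
  have h1 : ∀ i : ℕ, ∑ e ∈ Finset.range (i + 1), X i e = X i 0 + ∑ e ∈ Finset.range i, X i (e + 1) := by
    intro i; rw [Finset.sum_range_succ', add_comm]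
  simp only [h1, mul_add, Finset.sum_add_distrib]
  rw [Finset.sum_range_succ' (fun i => (-1 : K) ^ i * ∑ e ∈ Finset.range i, X i (e + 1))]
  simp only [Finset.range_zero, Finset.sum_empty, mul_zero, add_zero, pow_succ]
  have : ∑ i ∈ Finset.range (L + 1), (-1 : K) ^ i * (-1) * ∑ e ∈ Finset.range (i + 1), X (i + 1) (e + 1) =
      -∑ i ∈ Finset.range (L + 1), (-1 : K) ^ i * ∑ e ∈ Finset.range (i + 1), X (i + 1) (e + 1) := by
    rw [← Finset.sum_neg_distrib]
    refine Finset.sum_congr rfl fun i _ => by ring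
  rw [this]
  abel

/-- **The compatibility identity (δ)** — IKZ's family (v) and the Kaneko–Yamamoto family agree
formally: for `s = (a'+1) t` and `l = L + 1 ≥ 1`, substituting the integral–series values
`F(i, b, t') = Σ_{c ∈ (1^{i+1})⋆} Σ_{w ∈ t' ∗ c.tail} g((b + c₁) w)` for `(-1)^i ⟨ψ, reg_ш(yⁱ x v)⟩` in
the leading-ones decomposition of `Σ_{u ∈ s ∗ 1ˡ} ⟨ψ, reg_ш u⟩` gives identically `0`:
the `e ≥ 1` parts telescope (`formal_telescope`) and the `e = 0` part is the `e`–`h`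
cancellation (`eh_cancellation`). [cite: KanekoYamamoto2018, Prop. 5.4; IharaKanekoZagier2006, Thm 2 (v)] -/
theorem delta_identity (g : List ℕ → K) (a' : ℕ) (t : List ℕ) (L : ℕ) :
    ∑ i ∈ Finset.range (L + 2), (-1 : K) ^ i *
        sumStuffle (fun t' => ((starIndices (List.replicate (i + 1) 1)).map fun c =>
          sumStuffle (g ∘ List.cons (a' + c.headD 0)) t' c.tail).sum) t (List.replicate (L + 1 - i) 1) +
      ∑ i ∈ Finset.range (L + 1), (-1 : K) ^ i *
        sumStuffle (fun t' => ((starIndices (List.replicate (i + 1) 1)).map fun c =>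
          sumStuffle (g ∘ List.cons (a' + 1 + c.headD 0)) t' c.tail).sum) t (List.replicate (L - i) 1) = 0 := by
  simp only [sumStuffle_F_eq]
  have key := formal_telescope (fun i e => ((starIndices (List.replicate (i - e) 1)).map fun d =>
    sumStuffle (fun v => sumStuffle (g ∘ List.cons (a' + 1 + e)) t v) (List.replicate (L + 1 - i) 1) d).sum) L
  simp only [Nat.add_sub_add_right, Nat.sub_zero] at key
  simp only [show ∀ e : ℕ, a' + 1 + 1 + e = a' + 1 + (e + 1) from fun e => by omega]
  have eh := eh_cancellation L (fun v => sumStuffle (g ∘ List.cons (a' + 1)) t v)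
  simp only [Nat.add_zero] at key
  linear_combination key + eh

/-! ### The leading-ones decomposition of `Σ_{u ∈ s ∗ 1ˡ}` -/

/-- **Leading-ones decomposition of a harmonic product with ones**: for `s = a t`,
`Σ_{u ∈ s ∗ 1ˡ} G u = Σ_{i ≤ l} Σ_{t' ∈ t ∗ 1^{l-i}} G(1ⁱ a t') + Σ_{i < l} Σ_{t' ∈ t ∗ 1^{l-1-i}} G(1ⁱ (a+1) t')`
— an index of `s ∗ 1ˡ` with exactly `i` leading ones continues with `a` (then a member of
`t ∗ 1^{l-i}`) or with the contraction `a + 1` (then a member of `t ∗ 1^{l-1-i}`); iterate (A3).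
[cite: Hoffman1997, §2 (A3), Thm 3.1] -/
theorem sumStuffle_cons_replicate_one_eq {M : Type*} [AddCommMonoid M] (a : ℕ) (t : List ℕ) :
    ∀ (l : ℕ) (G : List ℕ → M), sumStuffle G (a :: t) (List.replicate l 1) =
      ∑ i ∈ Finset.range (l + 1),
          sumStuffle (G ∘ (List.replicate i 1 ++ ·) ∘ List.cons a) t (List.replicate (l - i) 1) +
        ∑ i ∈ Finset.range l,
          sumStuffle (G ∘ (List.replicate i 1 ++ ·) ∘ List.cons (a + 1)) t (List.replicate (l - 1 - i) 1)
  | 0, G => by simp [MZV.sumStuffle]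
  | l + 1, G => by
    rw [List.replicate_succ, MZV.sumStuffle_cons_cons, ← List.replicate_succ,
      sumStuffle_cons_replicate_one_eq a t l (G ∘ List.cons 1)]
    rw [Finset.sum_range_succ' (fun i => sumStuffle (G ∘ (List.replicate i 1 ++ ·) ∘ List.cons a) t
        (List.replicate (l + 1 - i) 1)),
      Finset.sum_range_succ' (fun i => sumStuffle (G ∘ (List.replicate i 1 ++ ·) ∘ List.cons (a + 1)) t
        (List.replicate (l + 1 - 1 - i) 1))]
    have hA : ∑ i ∈ Finset.range (l + 1), sumStuffle (G ∘ (List.replicate (i + 1) 1 ++ ·) ∘ List.cons a) t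
        (List.replicate (l + 1 - (i + 1)) 1) =
        ∑ i ∈ Finset.range (l + 1), sumStuffle ((G ∘ List.cons 1) ∘ (List.replicate i 1 ++ ·) ∘ List.cons a) t
        (List.replicate (l - i) 1) :=
      Finset.sum_congr rfl fun i _ => by rw [Nat.add_sub_add_right]; rfl
    have hB : ∑ i ∈ Finset.range l, sumStuffle (G ∘ (List.replicate (i + 1) 1 ++ ·) ∘ List.cons (a + 1)) t
        (List.replicate (l + 1 - 1 - (i + 1)) 1) =
        ∑ i ∈ Finset.range l, sumStuffle ((G ∘ List.cons 1) ∘ (List.replicate i 1 ++ ·) ∘ List.cons (a + 1)) t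
        (List.replicate (l - 1 - i) 1) :=
      Finset.sum_congr rfl fun i _ => by rw [show l + 1 - 1 - (i + 1) = l - 1 - i by omega]; rfl
    have hC : sumStuffle (G ∘ (List.replicate 0 1 ++ ·) ∘ List.cons a) t (List.replicate (l + 1 - 0) 1) =
        sumStuffle (G ∘ List.cons a) t (List.replicate (l + 1) 1) := rfl
    have hD : sumStuffle (G ∘ (List.replicate 0 1 ++ ·) ∘ List.cons (a + 1)) t
        (List.replicate (l + 1 - 1 - 0) 1) = sumStuffle (G ∘ List.cons (a + 1)) t (List.replicate l 1) := by
      rw [show l + 1 - 1 - 0 = l by omega]; rfl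
    rw [hA, hB, hC, hD]
    abel

end Summit.KontsevichZagierPeriods.FurushoPentagon.DoubleShuffleInKZ.IntegralSeries

end
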